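import Mathlib

/-!
# Crux `FeketeSOS.SOSMagnification` (stmt-ValiantsHypothesis-3995), line `sml-polarised-transport` —
stub `stub_budget` (T4): the eventual counting inequalities with growing radix `k = n + 1`

For every fixed `c : ℕ` and `δ > 0` there is an onset `n₀` such that for all `n ≥ n₀`, all
circuit sizes `L ≤ n ^ c + c` and all `p` in the Bertrand window `(n+1)^n < 2p ≤ 2(n+1)^n`:

* `n ≤ p` and `(n+1)^n - 1 ≤ p ^ 2` (side conditions of the SOS-hardness hypothesis);
* (a) `2^(n+1) · T ≤ p ^ δ`, where `T = (n+1) · (16 L² (n+1)⁴)^⌊log₂ n⌋` bounds the number of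
  products of the VSBR cut (so `2^(n+1) T` bounds the number of squares after polarisation);
* (b) `2^(n+1) · T · ((n+1)^(n/2) + (n+1)^(n - n/2)) < p ^ (1/2 + δ)` (the support sum).

Proof.  Everything except two monotonicity facts about `Real.rpow` is natural-number
bookkeeping.  With `m = ⌊log₂ n⌋` one has `n + 1 ≤ 2^(m+1)` and `L ≤ 2^((m+2)c+1)`, whence
`4 (n+1) · 2^(n+1) T ≤ 2^(n + (2c+9)(m+1)² - 4)` and `(2c+9)(m+1)² ≤ 2^m ≤ n` for
`m ≥ 10 (2c+10)` (`mul_sq_le_two_pow`), so `4 (n+1) · 2^(n+1) T ≤ 16^(n-1)` for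
`n ≥ 2^(10(2c+10))` (`nat_budget`).  On the real side, `(n+1)^δ ≥ 16` as soon as
`n ≥ ⌈16^(1/δ)⌉` (`sixteen_le_rpow`), and `p > (n+1)^n / 2 ≥ (n+1)^(n-1)` gives
`p^δ ≥ ((n+1)^δ)^(n-1) ≥ 16^(n-1)`, which is (a); squaring (b) reduces it to the natural-number
inequality `(2^(n+1) T · E)² < p · 256^(n-1)` (`sq_support_lt`, using `E² ≤ 4 (n+1)^(n+1)`).
The onset produced is `2^(10(2c+10)) + ⌈16^(1/δ)⌉ + 1` (not sharp; the planner's numerics give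
onsets of a few hundred for `δ = 1/2`).
-/

noncomputable section

-- `Summit.ValiantsHypothesis.ValiantsHypothesis.…` is the tree's mandated single-conjunct layout
-- (Sub = Summit), so the duplicated namespace component is intended.
set_option linter.dupNamespace false

namespace Summit.ValiantsHypothesis.ValiantsHypothesis.Theorems.FeketeSOSSOSMagnification

/-- Polynomial versus exponential growth, in the explicit form used below:
`A (m+1)² ≤ 2^m` as soon as `m ≥ 10 (A+1)`. [folklore] -/
theorem mul_sq_le_two_pow (A m : ℕ) (hm : 10 * (A + 1) ≤ m) : A * (m + 1) ^ 2 ≤ 2 ^ m := by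
  obtain ⟨q, hq1, hq2⟩ : ∃ q, 5 * q ≤ m ∧ m < 5 * q + 5 := ⟨m / 5, by omega, by omega⟩
  have h1 : q < 2 ^ q := Nat.lt_two_pow_self
  have h2 : A < 2 ^ A := Nat.lt_two_pow_self
  have h3 : m + 1 ≤ 8 * 2 ^ q := by omega
  calc A * (m + 1) ^ 2 ≤ 2 ^ A * (8 * 2 ^ q) ^ 2 := Nat.mul_le_mul h2.le (Nat.pow_le_pow_left h3 2)
    _ = 2 ^ (A + (2 * q + 6)) := by ring
    _ ≤ 2 ^ m := Nat.pow_le_pow_right (by norm_num) (by omega)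

/-- The natural-number budget: for `n ≥ 2^(10(2c+10))` and every `L ≤ n^c + c`,
`4 (n+1) · (2^(n+1) · T) ≤ 16^(n-1)` where `T = (n+1) · ((4L(n+1)²)·(4L(n+1)²))^⌊log₂ n⌋`.
[folklore] -/
theorem nat_budget (c : ℕ) : ∃ n₁ : ℕ, ∀ n : ℕ, n₁ ≤ n → ∀ L : ℕ, L ≤ n ^ c + c →
    4 * (n + 1) * (2 ^ (n + 1) *
      ((n + 1) * ((4 * L * (n + 1) ^ 2) * (4 * L * (n + 1) ^ 2)) ^ Nat.log 2 n)) ≤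
        16 ^ (n - 1) := by
  refine ⟨2 ^ (10 * (2 * c + 10)), fun n hn L hL => ?_⟩
  have hn0 : n ≠ 0 := by
    have : 1 ≤ 2 ^ (10 * (2 * c + 10)) := Nat.one_le_two_pow
    omega
  have hm : 10 * (2 * c + 9 + 1) ≤ Nat.log 2 n :=
    le_trans (by omega) (Nat.le_log_of_pow_le one_lt_two hn)
  have h2m : 2 ^ Nat.log 2 n ≤ n := Nat.pow_log_le_self 2 hn0
  have hn2 : n + 1 ≤ 2 ^ (Nat.log 2 n + 1) := Nat.lt_pow_succ_log_self one_lt_two n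
  set m := Nat.log 2 n with hm_def
  -- the exponent identity behind the final comparison
  have hkey : 2 * m + 9 + 2 * (((m + 2) * c + 2 * m + 5) * m) + (2 * c + 5 * m ^ 2 + 6 * m)
      = (2 * c + 9) * (m + 1) ^ 2 := by ring
  have hgrow : (2 * c + 9) * (m + 1) ^ 2 ≤ 2 ^ m := mul_sq_le_two_pow _ _ hm
  have hc2 : c < 2 ^ c := Nat.lt_two_pow_self
  -- `L ≤ 2^((m+2)c+1)`
  have hL2 : L ≤ 2 ^ ((m + 2) * c + 1) := by
    have h1 : n ^ c ≤ 2 ^ ((m + 1) * c) := by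
      rw [pow_mul]; exact Nat.pow_le_pow_left (by omega) c
    have h2 : 2 ^ ((m + 1) * c) ≤ 2 ^ ((m + 2) * c) :=
      Nat.pow_le_pow_right (by norm_num) (Nat.mul_le_mul_right c (by omega))
    have h3 : 2 ^ c ≤ 2 ^ ((m + 2) * c) :=
      Nat.pow_le_pow_right (by norm_num) (Nat.le_mul_of_pos_left c (by omega))
    calc L ≤ n ^ c + c := hL
      _ ≤ 2 ^ ((m + 2) * c) + 2 ^ ((m + 2) * c) := by omega
      _ = 2 ^ ((m + 2) * c + 1) := by rw [pow_succ]; omega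
  set v := (m + 2) * c + 2 * m + 5 with hv
  -- `4 L (n+1)² ≤ 2^v`
  have h4L : 4 * L * (n + 1) ^ 2 ≤ 2 ^ v := by
    calc 4 * L * (n + 1) ^ 2 ≤ 4 * 2 ^ ((m + 2) * c + 1) * (2 ^ (m + 1)) ^ 2 :=
          Nat.mul_le_mul (Nat.mul_le_mul_left 4 hL2) (Nat.pow_le_pow_left hn2 2)
      _ = 2 ^ v := by rw [hv]; ring
  have hsq : (4 * L * (n + 1) ^ 2) * (4 * L * (n + 1) ^ 2) ≤ 2 ^ (2 * v) := by
    calc _ ≤ 2 ^ v * 2 ^ v := Nat.mul_le_mul h4L h4L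
      _ = 2 ^ (2 * v) := by ring
  have hpw : ((4 * L * (n + 1) ^ 2) * (4 * L * (n + 1) ^ 2)) ^ m ≤ 2 ^ (2 * (v * m)) := by
    calc _ ≤ (2 ^ (2 * v)) ^ m := Nat.pow_le_pow_left hsq m
      _ = 2 ^ (2 * (v * m)) := by rw [← pow_mul, Nat.mul_assoc]
  have hall : 4 * (n + 1) * (2 ^ (n + 1) *
      ((n + 1) * ((4 * L * (n + 1) ^ 2) * (4 * L * (n + 1) ^ 2)) ^ m))
        ≤ 2 ^ (n + 2 * m + 5 + 2 * (v * m)) := by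
    calc _ ≤ 4 * 2 ^ (m + 1) * (2 ^ (n + 1) * (2 ^ (m + 1) * 2 ^ (2 * (v * m)))) :=
          Nat.mul_le_mul (Nat.mul_le_mul_left 4 hn2)
            (Nat.mul_le_mul_left _ (Nat.mul_le_mul hn2 hpw))
      _ = 2 ^ (n + 2 * m + 5 + 2 * (v * m)) := by ring
  have hexp : n + 2 * m + 5 + 2 * (v * m) ≤ 4 * (n - 1) := by omega
  calc _ ≤ 2 ^ (n + 2 * m + 5 + 2 * (v * m)) := hall
    _ ≤ 2 ^ (4 * (n - 1)) := Nat.pow_le_pow_right (by norm_num) hexp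
    _ = 16 ^ (n - 1) := by rw [pow_mul]; norm_num

/-- Squaring the support-sum inequality: if `4 (n+1) S ≤ 16^(n-1)` and `(n+1)^n < 2p` then
`(S · ((n+1)^(n/2) + (n+1)^(n-n/2)))² < p · 256^(n-1)` (using
`((n+1)^(n/2) + (n+1)^(n-n/2))² ≤ 4 (n+1)^(n+1)`). [folklore] -/
theorem sq_support_lt {n p S : ℕ} (hn : 1 ≤ n) (hB : 4 * (n + 1) * S ≤ 16 ^ (n - 1))
    (hp : (n + 1) ^ n < 2 * p) :
    (S * ((n + 1) ^ (n / 2) + (n + 1) ^ (n - n / 2))) ^ 2 < p * (16 ^ (n - 1)) ^ 2 := by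
  have hE1 : (n + 1) ^ (n / 2) ≤ (n + 1) ^ (n - n / 2) :=
    Nat.pow_le_pow_right (by omega) (by omega)
  have hE2 : ((n + 1) ^ (n - n / 2)) ^ 2 ≤ (n + 1) ^ (n + 1) := by
    rw [← pow_mul]; exact Nat.pow_le_pow_right (by omega) (by omega)
  have hpow : (n + 1) ^ (n + 1) ≤ 2 * ((n + 1) ^ n * (n + 1) ^ 2) := by
    calc (n + 1) ^ (n + 1) ≤ (n + 1) ^ (n + 2) := Nat.pow_le_pow_right (by omega) (by omega)
      _ = (n + 1) ^ n * (n + 1) ^ 2 := pow_add _ _ _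
      _ ≤ 2 * ((n + 1) ^ n * (n + 1) ^ 2) := by omega
  have key : 2 * (S * ((n + 1) ^ (n / 2) + (n + 1) ^ (n - n / 2))) ^ 2
      ≤ (4 * (n + 1) * S) ^ 2 * (n + 1) ^ n := by
    calc 2 * (S * ((n + 1) ^ (n / 2) + (n + 1) ^ (n - n / 2))) ^ 2
          ≤ 2 * (S * (2 * (n + 1) ^ (n - n / 2))) ^ 2 :=
          Nat.mul_le_mul_left 2 (Nat.pow_le_pow_left (Nat.mul_le_mul_left S (by omega)) 2)
      _ = 8 * S ^ 2 * ((n + 1) ^ (n - n / 2)) ^ 2 := by ring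
      _ ≤ 8 * S ^ 2 * (n + 1) ^ (n + 1) := Nat.mul_le_mul_left _ hE2
      _ ≤ 8 * S ^ 2 * (2 * ((n + 1) ^ n * (n + 1) ^ 2)) := Nat.mul_le_mul_left _ hpow
      _ = (4 * (n + 1) * S) ^ 2 * (n + 1) ^ n := by ring
  have hW : (4 * (n + 1) * S) ^ 2 * (n + 1) ^ n ≤ (16 ^ (n - 1)) ^ 2 * (n + 1) ^ n :=
    Nat.mul_le_mul_right _ (Nat.pow_le_pow_left hB 2)
  have hlt : (16 ^ (n - 1)) ^ 2 * (n + 1) ^ n < (16 ^ (n - 1)) ^ 2 * (2 * p) :=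
    Nat.mul_lt_mul_of_pos_left hp (by positivity)
  have h2 : 2 * (S * ((n + 1) ^ (n / 2) + (n + 1) ^ (n - n / 2))) ^ 2
      < 2 * (p * (16 ^ (n - 1)) ^ 2) := by
    calc _ ≤ _ := key
      _ ≤ _ := hW
      _ < _ := hlt
      _ = 2 * (p * (16 ^ (n - 1)) ^ 2) := by ring
  omega

/-- The real threshold: `16 ≤ (n+1)^δ` for all `n ≥ ⌈16^(1/δ)⌉`. [folklore] -/
theorem sixteen_le_rpow {δ : ℝ} (hδ : 0 < δ) :
    ∃ K : ℕ, ∀ n : ℕ, K ≤ n → (16 : ℝ) ≤ ((n : ℝ) + 1) ^ δ := by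
  refine ⟨⌈(16 : ℝ) ^ (1 / δ)⌉₊, fun n hn => ?_⟩
  have h1 : (16 : ℝ) ^ (1 / δ) ≤ (n : ℝ) + 1 := by
    have ha := Nat.le_ceil ((16 : ℝ) ^ (1 / δ))
    have hb : (⌈(16 : ℝ) ^ (1 / δ)⌉₊ : ℝ) ≤ n := by exact_mod_cast hn
    linarith
  calc (16 : ℝ) = ((16 : ℝ) ^ (1 / δ)) ^ δ := by
        rw [← Real.rpow_mul (by norm_num), one_div_mul_cancel hδ.ne', Real.rpow_one]
    _ ≤ ((n : ℝ) + 1) ^ δ := Real.rpow_le_rpow (by positivity) h1 hδ.le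

/-- The real-analysis wrapper: from `16 ≤ (n+1)^δ`, `(n+1)^(n-1) < p`, `S ≤ 16^(n-1)` and
`(S E)² < p · 256^(n-1)` conclude `S ≤ p^δ` and `S E < p^(1/2+δ)`. [folklore] -/
theorem real_part {n p S E : ℕ} {δ : ℝ} (hδ : 0 < δ) (h16 : (16 : ℝ) ≤ ((n : ℝ) + 1) ^ δ)
    (hNp : (n + 1) ^ (n - 1) < p) (hS : S ≤ 16 ^ (n - 1))
    (hmain : (S * E) ^ 2 < p * (16 ^ (n - 1)) ^ 2) :
    (S : ℝ) ≤ (p : ℝ) ^ δ ∧ ((S * E : ℕ) : ℝ) < (p : ℝ) ^ (1 / 2 + δ) := by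
  have hp0 : (0 : ℝ) < p := by exact_mod_cast (by omega : 0 < p)
  have hx : (0 : ℝ) ≤ (n : ℝ) + 1 := by positivity
  have hcast : ((n : ℝ) + 1) ^ (n - 1) ≤ (p : ℝ) := by exact_mod_cast hNp.le
  have hpδ : (16 : ℝ) ^ (n - 1) ≤ (p : ℝ) ^ δ := by
    calc (16 : ℝ) ^ (n - 1) ≤ (((n : ℝ) + 1) ^ δ) ^ (n - 1) := pow_le_pow_left₀ (by norm_num) h16 _
      _ = (((n : ℝ) + 1) ^ (n - 1)) ^ δ := Real.rpow_pow_comm hx δ (n - 1)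
      _ ≤ (p : ℝ) ^ δ := Real.rpow_le_rpow (by positivity) hcast hδ.le
  constructor
  · calc (S : ℝ) ≤ (16 : ℝ) ^ (n - 1) := by exact_mod_cast hS
      _ ≤ (p : ℝ) ^ δ := hpδ
  · have hY : (0 : ℝ) ≤ (p : ℝ) ^ (1 / 2 + δ) := Real.rpow_nonneg hp0.le _
    refine lt_of_pow_lt_pow_left₀ 2 hY ?_
    have hY2 : ((p : ℝ) ^ (1 / 2 + δ)) ^ 2 = (p : ℝ) * ((p : ℝ) ^ δ) ^ 2 := by
      rw [sq, sq, ← Real.rpow_add hp0, ← Real.rpow_add hp0,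
        show (1 : ℝ) / 2 + δ + (1 / 2 + δ) = 1 + (δ + δ) by ring, Real.rpow_add hp0 1 (δ + δ),
        Real.rpow_one]
    rw [hY2]
    calc ((S * E : ℕ) : ℝ) ^ 2 < (p : ℝ) * ((16 : ℝ) ^ (n - 1)) ^ 2 := by exact_mod_cast hmain
      _ ≤ (p : ℝ) * ((p : ℝ) ^ δ) ^ 2 :=
          mul_le_mul_of_nonneg_left (pow_le_pow_left₀ (by positivity) hpδ 2) hp0.le

/-- **Stub `stub_budget` (T4) of line `sml-polarised-transport`.**  For every `c` and every
`δ > 0`, eventually in `n`: for all `L ≤ n^c + c` and all `p` with `(n+1)^n < 2p ≤ 2(n+1)^n`,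
`n ≤ p`, `(n+1)^n - 1 ≤ p²`, the polarised square count `2^(n+1) T` is at most `p^δ`, and the
support sum `2^(n+1) T ((n+1)^(n/2) + (n+1)^(n-n/2))` is `< p^(1/2+δ)`, where
`T = (n+1) ((4L(n+1)²)(4L(n+1)²))^⌊log₂ n⌋`. [folklore] -/
theorem stub_budget :
    ∀ (c : ℕ) (δ : ℝ), 0 < δ → ∃ n₀ : ℕ, ∀ n : ℕ, n₀ ≤ n → ∀ L : ℕ, L ≤ n ^ c + c →
      ∀ p : ℕ, (n + 1) ^ n < 2 * p → p ≤ (n + 1) ^ n →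
        n ≤ p ∧ (n + 1) ^ n - 1 ≤ p ^ 2 ∧
        ((2 ^ (n + 1) * ((n + 1) * ((4 * L * (n + 1) ^ 2) * (4 * L * (n + 1) ^ 2)) ^ Nat.log 2 n) : ℕ) : ℝ)
            ≤ (p : ℝ) ^ δ ∧
        ((2 ^ (n + 1) * ((n + 1) * ((4 * L * (n + 1) ^ 2) * (4 * L * (n + 1) ^ 2)) ^ Nat.log 2 n) *
            ((n + 1) ^ (n / 2) + (n + 1) ^ (n - n / 2)) : ℕ) : ℝ) < (p : ℝ) ^ (1 / 2 + δ) := by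
  intro c δ hδ
  obtain ⟨n₁, hn₁⟩ := nat_budget c
  obtain ⟨K, hK⟩ := sixteen_le_rpow hδ
  refine ⟨n₁ + K + 1, fun n hn L hL p hp1 _hp2 => ?_⟩
  have hB := hn₁ n (by omega) L hL
  have h16 := hK n (by omega)
  have hn1 : 1 ≤ n := by omega
  have hpow : (n + 1) ^ n = (n + 1) ^ (n - 1) * (n + 1) := by
    rw [← pow_succ, Nat.sub_add_cancel hn1]
  have hNp : (n + 1) ^ (n - 1) < p := by
    have : 2 * (n + 1) ^ (n - 1) ≤ (n + 1) ^ (n - 1) * (n + 1) := by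
      rw [mul_comm]; exact Nat.mul_le_mul_left _ (by omega)
    omega
  have hnp : n ≤ p := by
    have h1 : n - 1 < 2 ^ (n - 1) := Nat.lt_two_pow_self
    have h3 : 2 ^ n = 2 ^ (n - 1) * 2 := by rw [← pow_succ, Nat.sub_add_cancel hn1]
    have h2 : 2 ^ n ≤ (n + 1) ^ n := Nat.pow_le_pow_left (by omega) n
    omega
  have hii : (n + 1) ^ n - 1 ≤ p ^ 2 := by
    have hp2 : 2 ≤ p := by
      have : 0 < (n + 1) ^ (n - 1) := by positivity
      omega
    have : 2 * p ≤ p ^ 2 := by rw [sq]; exact Nat.mul_le_mul_right p hp2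
    omega
  have hS : 2 ^ (n + 1) * ((n + 1) * ((4 * L * (n + 1) ^ 2) * (4 * L * (n + 1) ^ 2)) ^ Nat.log 2 n)
      ≤ 16 ^ (n - 1) :=
    le_trans (Nat.le_mul_of_pos_left _ (by positivity)) hB
  exact ⟨hnp, hii, real_part hδ h16 hNp hS (sq_support_lt hn1 hB hp1)⟩

end Summit.ValiantsHypothesis.ValiantsHypothesis.Theorems.FeketeSOSSOSMagnification
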